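import Literature.NumberTheory.LFunctions.VanDerCorputZeta
import HarnessLib

/-!
# The explicit `A`-process (Weyl differencing): Yang 2024, Lemma 2.3 (Patel–Yang, Lemma 1.2)

Topic `Literature/NumberTheory/LFunctions`. A. Yang, *Explicit bounds on `ζ(s)` in the critical
strip and a zero-free region*, J. Math. Anal. Appl. 534 (2024) = arXiv:2301.03165, Lemma 2.3
(explicit `A` process; Cheng–Graham 2004 Lemma 5, Platt–Trudgian 2015 Lemma 2, with the factor
`N - 1 + q`): "Let `f(x)` be real-valued and defined on `(a, a + N]`, for some integers `a, N`.
For all integers `q > 0`, we have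
`(S_f(a, N))² ≤ (N - 1 + q)(N/q + (2/q) ∑_{r=1}^{q-1} (1 - r/q) S_{g_r}(a, N - r))`
where `g_r(x) := f(x + r) - f(x)`", `S_f(a, N) = |∑_{a<n≤a+N} e(f(n))|`. This is Lemma 1.2 of
Patel–Yang (J. Number Theory 262 (2024)), the `A`-process of their explicit sub-Weyl bound.

Everything here is PROVED. The tree's `Literature.NumberTheory.LFunctions.VdC.vanDerCorput_ineq`
(Graham–Kolesnik Lemma 2.5) drops the triangular weights `1 - r/q`; here they are kept:
`H·S = ∑_{m} ∑_{j<H} z(m+j)` over the `N + H - 1` integers `m ∈ (a - H + 1, b]`, Cauchy–Schwarz,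
and `∑_{j,j'<H} C(j - j') = H·C(0) + 2 Re ∑_{d=1}^{H-1} (H - d) C(d)` for the correlations
`C(d) = ∑ z(n+d) conj z(n)` (`Literature.NumberTheory.LFunctions.VdC.corr`).

## Main results

* `Literature.NumberTheory.LFunctions.VdC.sum_range_sum_range_eq` — the counting identity
  `∑_{j<H} ∑_{i<j} w(i) = ∑_{i<H} (H - 1 - i) w(i)` (`= ∑_{d=1}^{H-1} (H - d) G(d)` for `w(i) = G(i+1)`).
* `Literature.NumberTheory.LFunctions.VdC.vanDerCorput_weighted` — for `z` supported in `(a, b]`: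
  `H² ‖∑ z(n)‖² ≤ (b - a + H - 1)(H ‖C(0)‖ + 2 ∑_{i<H} (H - 1 - i) ‖C(i+1)‖)`.
* `Literature.NumberTheory.LFunctions.VdC.aProcess_yang` — **Yang's Lemma 2.3**:
  `‖∑_{a<n≤b} e(f(n))‖² ≤ (N - 1 + q)(N/q + (2/q) ∑_{r=1}^{q-1} (1 - r/q) ‖∑_{a<n≤b-r} e(f(n+r) - f(n))‖)`,
  `N = b - a`.

## References

* A. Yang, *Explicit bounds on `ζ(s)` in the critical strip and a zero-free region*, J. Math.
  Anal. Appl. 534 (2024) 128124 = arXiv:2301.03165v3, Lemma 2.3. [cite: Yang2024, Lemma 2.3]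
* D. Patel, A. Yang, *An explicit sub-Weyl bound for `ζ(1/2 + it)`*, J. Number Theory 262
  (2024) 301–334, Lemma 1.2. [cite: PatelYang2024, Lemma 1.2]
* S. W. Graham, G. Kolesnik, *Van der Corput's Method of Exponential Sums*, LMS LN 126 (1991),
  Lemma 2.5.
-/

noncomputable section

open Finset Real

namespace Literature.NumberTheory.LFunctions
namespace VdC

/-! ### The triangular counting identity -/

/-- `∑_{j<H} ∑_{i<j} w(i) = ∑_{i<H} (H - 1 - i) w(i)` (with `w(i) = G(i+1)`:
`∑_{j<H} ∑_{d=1}^{j} G(d) = ∑_{d=1}^{H-1} (H - d) G(d)`). [folklore] -/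
theorem sum_range_sum_range_eq (w : ℕ → ℝ) (H : ℕ) :
    ∑ j ∈ Finset.range H, ∑ i ∈ Finset.range j, w i
      = ∑ i ∈ Finset.range H, ((H : ℝ) - 1 - i) * w i := by
  induction H with
  | zero => simp
  | succ H ih =>
    rw [Finset.sum_range_succ, ih, Finset.sum_range_succ]
    push_cast
    have : ∑ i ∈ Finset.range H, ((H : ℝ) + 1 - 1 - i) * w i
        = ∑ i ∈ Finset.range H, ((H : ℝ) - 1 - i) * w i + ∑ i ∈ Finset.range H, w i := by
      rw [← Finset.sum_add_distrib]
      exact Finset.sum_congr rfl fun d _ => by ring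
    rw [this]
    ring

/-- The reflected form: `∑_{j<H} ∑_{i<H-1-j} w(i) = ∑_{i<H} (H - 1 - i) w(i)`. [folklore] -/
theorem sum_range_sum_range_reflect_eq (w : ℕ → ℝ) (H : ℕ) :
    ∑ j ∈ Finset.range H, ∑ i ∈ Finset.range (H - 1 - j), w i
      = ∑ i ∈ Finset.range H, ((H : ℝ) - 1 - i) * w i := by
  rw [← sum_range_sum_range_eq w H]
  exact Finset.sum_range_reflect (fun j => ∑ i ∈ Finset.range j, w i) H

/-! ### The weighted Weyl–van der Corput inequality -/

section support

variable {z : ℤ → ℂ} {a b : ℤ} (hz : ∀ n, n ∉ Finset.Ioc a b → z n = 0)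
include hz

/-- The real part of the correlation is even in the shift: `Re C(-d) = Re C(d)`. [folklore] -/
theorem corr_re_neg {d : ℤ} (hd : 0 ≤ d) : (corr z a b (-d)).re = (corr z a b d).re := by
  rw [corr_neg hz hd, Complex.conj_re]

omit hz in
/-- Row `j`, lower part: `∑_{j'<j} Re C(j - j') = ∑_{i<j} Re C(i+1)`. [folklore] -/
theorem row_lower_eq (j : ℕ) :
    ∑ j' ∈ Finset.range j, (corr z a b ((j : ℤ) - j')).re
      = ∑ i ∈ Finset.range j, (corr z a b ((i : ℤ) + 1)).re := by
  rw [← Finset.sum_range_reflect (fun i => (corr z a b ((i : ℤ) + 1)).re) j]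
  refine Finset.sum_congr rfl fun j' hj' => ?_
  rw [Finset.mem_range] at hj'
  have e : (((j - 1 - j' : ℕ) : ℤ)) + 1 = (j : ℤ) - j' := by
    have h1 : j' + 1 ≤ j := hj'
    have h2 : ((j - 1 - j' : ℕ) : ℤ) = ((j : ℕ) : ℤ) - 1 - j' := by
      rw [Nat.sub_sub, Nat.cast_sub (by omega)]
      push_cast; ring
    rw [h2]; ring
  rw [e]

/-- Row `j`, upper part: `∑_{j<j'<H} Re C(j - j') = ∑_{i<H-1-j} Re C(i+1)` (`j < H`). [folklore] -/
theorem row_upper_eq {H j : ℕ} (hj : j < H) :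
    ∑ j' ∈ Finset.Ico (j + 1) H, (corr z a b ((j : ℤ) - j')).re
      = ∑ i ∈ Finset.range (H - 1 - j), (corr z a b ((i : ℤ) + 1)).re := by
  rw [Finset.sum_Ico_eq_sum_range, show H - (j + 1) = H - 1 - j by omega]
  refine Finset.sum_congr rfl fun i _ => ?_
  have e : (j : ℤ) - ((j + 1 + i : ℕ) : ℤ) = -(((i : ℤ) + 1)) := by push_cast; ring
  rw [e, corr_re_neg hz (by positivity)]

/-- Row `j` of the double sum of correlations (`j < H`):
`∑_{j'<H} Re C(j - j') = ∑_{i<j} Re C(i+1) + Re C(0) + ∑_{i<H-1-j} Re C(i+1)`. [folklore] -/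
theorem row_sum_eq {H j : ℕ} (hj : j < H) :
    ∑ j' ∈ Finset.range H, (corr z a b ((j : ℤ) - j')).re
      = ∑ i ∈ Finset.range j, (corr z a b ((i : ℤ) + 1)).re + (corr z a b 0).re
        + ∑ i ∈ Finset.range (H - 1 - j), (corr z a b ((i : ℤ) + 1)).re := by
  rw [Finset.range_eq_Ico, ← Finset.sum_Ico_consecutive _ (Nat.zero_le j) hj.le,
    Finset.sum_eq_sum_Ico_succ_bot hj, sub_self, ← Finset.range_eq_Ico, row_lower_eq,
    row_upper_eq hz hj]
  ring

/-- **Weighted Weyl–van der Corput inequality.** For `z` supported in `(a, b]` (`a ≤ b`) and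
`1 ≤ H`: `H² ‖∑ z(n)‖² ≤ (b - a + H - 1)(H ‖C(0)‖ + 2 ∑_{i<H} (H - 1 - i) ‖C(i+1)‖)`
(i.e. `2 ∑_{d=1}^{H-1} (H - d) ‖C(d)‖`).
[cite: Yang2024, Lemma 2.3 (proof: Cheng–Graham Lemma 5, Platt–Trudgian Lemma 2)] -/
theorem vanDerCorput_weighted (hab : a ≤ b) {H : ℕ} (hH : 1 ≤ H) :
    (H : ℝ) ^ 2 * ‖∑ n ∈ Finset.Ioc a b, z n‖ ^ 2
      ≤ ((b : ℝ) - a + H - 1) * (H * ‖corr z a b 0‖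
          + 2 * ∑ i ∈ Finset.range H, ((H : ℝ) - 1 - i) * ‖corr z a b ((i : ℤ) + 1)‖) := by
  set S := ∑ n ∈ Finset.Ioc a b, z n with hS
  set M : Finset ℤ := Finset.Ioc (a - H + 1) b with hM
  have hcardM : (M.card : ℝ) = (b : ℝ) - a + H - 1 := by
    rw [hM, Int.card_Ioc]
    have h0 : 0 ≤ b - (a - H + 1) := by omega
    have h1 : (((b - (a - H + 1)).toNat : ℕ) : ℤ) = b - (a - H + 1) := Int.toNat_of_nonneg h0
    have h2 : (((b - (a - H + 1)).toNat : ℕ) : ℝ) = ((b - (a - H + 1) : ℤ) : ℝ) := by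
      exact_mod_cast h1
    rw [h2]; push_cast; ring
  -- Step 1: `H S = ∑_{m ∈ M} ∑_{j < H} z(m + j)`
  have hshift : ∀ j ∈ Finset.range H, ∑ m ∈ M, z (m + j) = S := by
    intro j hj
    rw [Finset.mem_range] at hj
    rw [hM, sum_Ioc_shift, hS]
    exact sum_eq_sum_of_vanish (Finset.Ioc_subset_Ioc (by omega) (by omega)) hz
  have hHS : (H : ℂ) * S = ∑ m ∈ M, ∑ j ∈ Finset.range H, z (m + j) := by
    rw [Finset.sum_comm, Finset.sum_congr rfl hshift, Finset.sum_const, Finset.card_range,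
      nsmul_eq_mul]
  -- Step 2: Cauchy–Schwarz
  have hCS := norm_sq_sum_le_card_mul M (fun m => ∑ j ∈ Finset.range H, z (m + j))
  -- Step 3: expand the squares
  have hexp : ∑ m ∈ M, ‖∑ j ∈ Finset.range H, z (m + j)‖ ^ 2
      = ∑ j ∈ Finset.range H, ∑ j' ∈ Finset.range H, (corr z a b ((j : ℤ) - j')).re := by
    have h1 : ∀ m ∈ M, ‖∑ j ∈ Finset.range H, z (m + j)‖ ^ 2
        = ∑ j ∈ Finset.range H, ∑ j' ∈ Finset.range H,
            (z (m + j) * (starRingEnd ℂ) (z (m + j'))).re :=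
      fun m _ => norm_sq_sum_eq _ _
    rw [Finset.sum_congr rfl h1, Finset.sum_comm]
    refine Finset.sum_congr rfl fun j hj => ?_
    rw [Finset.sum_comm]
    refine Finset.sum_congr rfl fun j' hj' => ?_
    rw [← Complex.re_sum]
    congr 1
    rw [Finset.mem_range] at hj hj'
    have h2 := sum_Ioc_shift (fun n => z (n + ((j : ℤ) - j')) * (starRingEnd ℂ) (z n)) (a - H + 1) b j'
    have h3 : ∀ m : ℤ, z (m + j) * (starRingEnd ℂ) (z (m + j'))
        = z (m + j' + ((j : ℤ) - j')) * (starRingEnd ℂ) (z (m + j')) := by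
      intro m
      have : m + j' + ((j : ℤ) - j') = m + j := by ring
      rw [this]
    rw [hM, Finset.sum_congr rfl (fun m _ => h3 m), h2]
    unfold corr
    apply sum_eq_sum_of_vanish (Finset.Ioc_subset_Ioc (by omega) (by omega))
    intro n hn
    simp only [hz n hn, map_zero, mul_zero]
  -- Step 4: the double sum with its triangular weights
  have hcorr : ∑ j ∈ Finset.range H, ∑ j' ∈ Finset.range H, (corr z a b ((j : ℤ) - j')).re
      ≤ H * ‖corr z a b 0‖
        + 2 * ∑ i ∈ Finset.range H, ((H : ℝ) - 1 - i) * ‖corr z a b ((i : ℤ) + 1)‖ := by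
    have hrows : ∀ j ∈ Finset.range H, ∑ j' ∈ Finset.range H, (corr z a b ((j : ℤ) - j')).re
        ≤ ∑ i ∈ Finset.range j, ‖corr z a b ((i : ℤ) + 1)‖ + ‖corr z a b 0‖
          + ∑ i ∈ Finset.range (H - 1 - j), ‖corr z a b ((i : ℤ) + 1)‖ := by
      intro j hj
      rw [Finset.mem_range] at hj
      rw [row_sum_eq hz hj]
      gcongr with i _ i _
      · exact Complex.re_le_norm _
      · exact Complex.re_le_norm _
      · exact Complex.re_le_norm _
    refine (Finset.sum_le_sum hrows).trans (le_of_eq ?_)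
    rw [Finset.sum_add_distrib, Finset.sum_add_distrib, Finset.sum_const, Finset.card_range,
      nsmul_eq_mul, sum_range_sum_range_eq (fun i => ‖corr z a b ((i : ℤ) + 1)‖) H,
      sum_range_sum_range_reflect_eq (fun i => ‖corr z a b ((i : ℤ) + 1)‖) H]
    ring
  -- assemble
  have hnormHS : (H : ℝ) ^ 2 * ‖S‖ ^ 2 = ‖(H : ℂ) * S‖ ^ 2 := by
    rw [norm_mul, Complex.norm_natCast]; ring
  rw [hnormHS, hHS]
  have hM0 : (0 : ℝ) ≤ (b : ℝ) - a + H - 1 := by rw [← hcardM]; positivity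
  calc ‖∑ m ∈ M, ∑ j ∈ Finset.range H, z (m + j)‖ ^ 2
      ≤ M.card * ∑ m ∈ M, ‖∑ j ∈ Finset.range H, z (m + j)‖ ^ 2 := hCS
    _ = ((b : ℝ) - a + H - 1) * ∑ j ∈ Finset.range H, ∑ j' ∈ Finset.range H,
          (corr z a b ((j : ℤ) - j')).re := by rw [hcardM, hexp]
    _ ≤ _ := mul_le_mul_of_nonneg_left hcorr hM0

end support

/-! ### Yang's Lemma 2.3 -/

/-- **Yang's explicit `A`-process** (Yang 2024, Lemma 2.3; Patel–Yang 2024, Lemma 1.2): for a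
real phase `f`, integers `a ≤ b` (`N = b - a`) and an integer `q ≥ 1`,
`‖∑_{a<n≤b} e(f(n))‖² ≤ (N - 1 + q)(N/q + (2/q) ∑_{r=1}^{q-1} (1 - r/q) ‖∑_{a<n≤b-r} e(f(n+r) - f(n))‖)`.
[cite: Yang2024, Lemma 2.3] [cite: PatelYang2024, Lemma 1.2] -/
theorem aProcess_yang (f : ℝ → ℝ) {a b : ℤ} (hab : a ≤ b) {q : ℕ} (hq : 1 ≤ q) :
    ‖∑ n ∈ Finset.Ioc a b, e (f n)‖ ^ 2
      ≤ (((b : ℝ) - a) - 1 + q) * (((b : ℝ) - a) / q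
        + 2 / q * ∑ r ∈ Finset.Ico 1 q, (1 - (r : ℝ) / q) *
            ‖∑ n ∈ Finset.Ioc a (b - r), e (f ((n + r : ℤ)) - f n)‖) := by
  classical
  have hqpos : (0 : ℝ) < q := by exact_mod_cast hq
  set z : ℤ → ℂ := fun n => if n ∈ Finset.Ioc a b then e (f n) else 0 with hzdef
  have hz : ∀ n, n ∉ Finset.Ioc a b → z n = 0 := fun n hn => by
    simp only [hzdef]; rw [if_neg hn]
  have hS : ∑ n ∈ Finset.Ioc a b, e (f n) = ∑ n ∈ Finset.Ioc a b, z n :=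
    Finset.sum_congr rfl fun n hn => by simp only [hzdef]; rw [if_pos hn]
  -- `‖C(0)‖ = N`
  have hC0 : ‖corr z a b 0‖ = (b : ℝ) - a := by
    unfold corr
    have h1 : ∀ n ∈ Finset.Ioc a b, z (n + 0) * (starRingEnd ℂ) (z n) = 1 := by
      intro n hn
      simp only [hzdef, add_zero]
      rw [if_pos hn, Complex.mul_conj, Complex.normSq_eq_norm_sq, norm_e]
      norm_num
    rw [Finset.sum_congr rfl h1, Finset.sum_const, nsmul_eq_mul, mul_one, Int.card_Ioc]
    have h2 : (((b - a).toNat : ℕ) : ℤ) = b - a := Int.toNat_of_nonneg (by omega)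
    have h3 : ‖(((b - a).toNat : ℕ) : ℂ)‖ = (((b - a).toNat : ℕ) : ℝ) := Complex.norm_natCast _
    rw [h3]
    have h4 : (((b - a).toNat : ℕ) : ℝ) = ((b - a : ℤ) : ℝ) := by exact_mod_cast h2
    rw [h4]; push_cast; ring
  -- the correlations are the differenced sums
  have hcorr : ∀ r ∈ Finset.Ico 1 q,
      ‖corr z a b r‖ = ‖∑ n ∈ Finset.Ioc a (b - r), e (f ((n + r : ℤ)) - f n)‖ := by
    intro r hr
    rw [Finset.mem_Ico] at hr
    rw [corr_eq_sum_Ioc_sub hz (by positivity)]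
    congr 1
    refine Finset.sum_congr rfl fun n hn => ?_
    rw [Finset.mem_Ioc] at hn
    have h1 : n ∈ Finset.Ioc a b := by rw [Finset.mem_Ioc]; omega
    have h2 : n + r ∈ Finset.Ioc a b := by rw [Finset.mem_Ioc]; omega
    simp only [hzdef]
    rw [if_pos h1, if_pos h2, e_sub]
  have hmain := vanDerCorput_weighted hz hab hq
  rw [← hS, hC0] at hmain
  -- rewrite the weighted sum over `i < q` as the sum over `r = i + 1 ∈ [1, q)` (the term `r = q`
  -- has weight `0`)
  set N : ℝ := (b : ℝ) - a with hN
  set T : ℝ := ∑ r ∈ Finset.Ico 1 q, ((q : ℝ) - r) * ‖corr z a b r‖ with hT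
  have hTi : ∑ i ∈ Finset.range q, ((q : ℝ) - 1 - i) * ‖corr z a b ((i : ℤ) + 1)‖ = T := by
    obtain ⟨q', rfl⟩ : ∃ q', q = q' + 1 := ⟨q - 1, by omega⟩
    rw [Finset.sum_range_succ, hT, Finset.sum_Ico_eq_sum_range, show q' + 1 - 1 = q' by omega]
    push_cast
    have : ((q' : ℝ) + 1 - 1 - q') * ‖corr z a b ((q' : ℤ) + 1)‖ = 0 := by ring
    rw [this, add_zero]
    refine Finset.sum_congr rfl fun i _ => ?_
    ring
  rw [hTi] at hmain
  have hfin : ∑ r ∈ Finset.Ico 1 q, (1 - (r : ℝ) / q) *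
        ‖∑ n ∈ Finset.Ioc a (b - r), e (f ((n + r : ℤ)) - f n)‖ = T / q := by
    rw [hT, Finset.sum_div]
    refine Finset.sum_congr rfl fun r hr => ?_
    rw [← hcorr r hr]
    field_simp
  rw [hfin]
  have hN1 : 0 ≤ N - 1 + q := by
    have : (1 : ℝ) ≤ q := by exact_mod_cast hq
    have : (a : ℝ) ≤ b := by exact_mod_cast hab
    rw [hN]; linarith
  have e1 : (N - 1 + q) * (N / q + 2 / q * (T / q)) = (N - 1 + q) * (q * N + 2 * T) / q ^ 2 := by
    field_simp
  rw [e1, le_div_iff₀ (by positivity)]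
  have e2 : N + q - 1 = N - 1 + q := by ring
  rw [e2] at hmain
  linarith

end VdC
end Literature.NumberTheory.LFunctions
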